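import Mathlib

/-!
# T5WedgeRank — the linear algebra of «ω_{ab} ≠ 0» (N1 support memo route/T5-N1-hodge-p6.md, H6 and
H7.2)

Two statements about a pair of (1,0)-covectors at a point of a complex surface, and about a pair
of cohomology classes in two subspaces meeting only in 0:

* `wedge10` — a (1,0)-covector at a point is `u = u₀ dz₁ + u₁ dz₂`, recorded as `u : Fin 2 → ℂ`; the
  wedge of two of them is `(u₀v₁ − u₁v₀) · dz₁ ∧ dz₂`, so `wedge10 u v := u 0 * v 1 - u 1 * v 0` is
  the coefficient of `dz₁ ∧ dz₂` in `u ∧ v`.  `wedge10_ne_zero_iff` is H6 (ii) ⟺ (iii): the wedge is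
  non-zero iff the two covectors are linearly independent iff the 2 × 2 matrix of their
  coordinates (the Jacobian of `F_{ab} = (z_a ∘ f̃_a, z_b ∘ f̃_b)`) is invertible.
* `not_linearIndependent_pair_iff_of_disjoint` — H7.2: if `u ∈ U`, `v ∈ V` with `U ⊓ V = ⊥`
  (two distinct isotypic components), then `u, v` are linearly dependent iff `u = 0` or `v = 0`.

Mathlib only; blind lane; standard axioms.  Nothing here is about S, the f_i, or any automorphic
object: the identification of the (1,0)-covectors `(f_a^*e_{a,σ})_s, (f_b^*e_{b,σ})_s` with
`u, v : Fin 2 → ℂ` in the coordinates `dz₁, dz₂` of Remark A4.2.8, and of the isotypic components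
with `U, V`, is the prose's.
-/

namespace Summit.Ventures.HodgeRepro2.T5WedgeRank

/-- The coefficient of `dz₁ ∧ dz₂` in the wedge `u ∧ v` of the (1,0)-covectors
`u = u 0 · dz₁ + u 1 · dz₂` and `v = v 0 · dz₁ + v 1 · dz₂`. -/
def wedge10 (u v : Fin 2 → ℂ) : ℂ := u 0 * v 1 - u 1 * v 0

/-- The wedge coefficient is the determinant of the 2 × 2 coordinate matrix (rows `u`, `v`). -/
theorem wedge10_eq_det (u v : Fin 2 → ℂ) : wedge10 u v = (Matrix.of ![u, v]).det := by
  rw [Matrix.det_fin_two]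
  simp [wedge10]

/-- Two vectors of `Fin 2 → ℂ` are linearly independent iff their coordinate matrix is invertible
(`Matrix.linearIndependent_rows_iff_isUnit`), i.e. iff its determinant is non-zero. -/
theorem linearIndependent_pair_iff_det_ne_zero (u v : Fin 2 → ℂ) :
    LinearIndependent ℂ ![u, v] ↔ (Matrix.of ![u, v]).det ≠ 0 := by
  rw [isUnit_iff_ne_zero.symm, ← Matrix.isUnit_iff_isUnit_det,
    ← Matrix.linearIndependent_rows_iff_isUnit]
  rfl

/-- H6 (ii) ⟺ (iii): `u ∧ v ≠ 0` at a point iff the two (1,0)-covectors are linearly independent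
there. -/
theorem wedge10_ne_zero_iff (u v : Fin 2 → ℂ) :
    wedge10 u v ≠ 0 ↔ LinearIndependent ℂ ![u, v] := by
  rw [wedge10_eq_det, linearIndependent_pair_iff_det_ne_zero]

/-- `u ∧ v = 0` iff `u`, `v` are linearly dependent. -/
theorem wedge10_eq_zero_iff (u v : Fin 2 → ℂ) :
    wedge10 u v = 0 ↔ ¬ LinearIndependent ℂ ![u, v] := by
  rw [← wedge10_ne_zero_iff, not_not]

/-- `u ∧ v` is antisymmetric. -/
theorem wedge10_swap (u v : Fin 2 → ℂ) : wedge10 v u = -wedge10 u v := by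
  simp only [wedge10]; ring

/-- If `u` and `v` are proportional (`v = c • u`) then `u ∧ v = 0`. -/
theorem wedge10_smul_self (u : Fin 2 → ℂ) (c : ℂ) : wedge10 u (c • u) = 0 := by
  simp only [wedge10, Pi.smul_apply, smul_eq_mul]; ring

/-- H7.2: two vectors lying in two subspaces that meet only in `0` are linearly dependent iff one
of them is `0`. -/
theorem not_linearIndependent_pair_iff_of_disjoint {K E : Type*} [Field K] [AddCommGroup E]
    [Module K E] {U V : Submodule K E} (hUV : Disjoint U V) {u v : E} (hu : u ∈ U) (hv : v ∈ V) :
    ¬ LinearIndependent K ![u, v] ↔ u = 0 ∨ v = 0 := by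
  rw [LinearIndependent.pair_iff]
  constructor
  · intro h
    by_contra hne
    rw [not_or] at hne
    apply h
    intro s t hst
    have h1 : s • u ∈ U := U.smul_mem s hu
    have h2 : s • u ∈ V := by
      have : s • u = -(t • v) := eq_neg_of_add_eq_zero_left hst
      rw [this]
      exact V.neg_mem (V.smul_mem t hv)
    have hsu : s • u = 0 := Submodule.disjoint_def.mp hUV _ h1 h2
    have htv : t • v = 0 := by
      have : t • v = -(s • u) := eq_neg_of_add_eq_zero_right hst
      rw [this, hsu, neg_zero]
    exact ⟨(smul_eq_zero.mp hsu).resolve_right hne.1, (smul_eq_zero.mp htv).resolve_right hne.2⟩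
  · rintro (rfl | rfl) h
    · have := h 1 0 (by simp)
      exact one_ne_zero this.1
    · have := h 0 1 (by simp)
      exact one_ne_zero this.2

/-- H7.2 in the form used in the memo: if both vectors are non-zero, they are linearly independent
(so case (i) of the Castelnuovo–de Franchis dichotomy H7.1 cannot occur). -/
theorem linearIndependent_pair_of_disjoint {K E : Type*} [Field K] [AddCommGroup E]
    [Module K E] {U V : Submodule K E} (hUV : Disjoint U V) {u v : E} (hu : u ∈ U) (hv : v ∈ V)
    (hu0 : u ≠ 0) (hv0 : v ≠ 0) : LinearIndependent K ![u, v] := by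
  by_contra h
  rcases (not_linearIndependent_pair_iff_of_disjoint hUV hu hv).mp h with h0 | h0
  · exact hu0 h0
  · exact hv0 h0

end Summit.Ventures.HodgeRepro2.T5WedgeRank
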